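import Summits.QuantumFields.YangMills.Theorems.UnitScaleTiltProp7SymFrameCovariance
import Summits.QuantumFields.YangMills.Theorems.UnitScaleTiltProp7SymFrameIterSmall
import Summits.QuantumFields.YangMills.Theorems.UnitScaleTiltProp7CmapSymInputs
import HarnessLib

/-!
# `UnitScaleTiltProp7SymFrameRelCluster` — W3 PART 1∕2 OF THE (47)-twˢ PLAN (OWNER RULINGS g26-№12 (3d)∕№13 (iii)): **THE RELATIVE TOP-LEVEL COVARIANT DOUBLE BAR
# `U̿^{(k)}(e)·Ū₀^{(k)}(e)⁻¹` AND THE ACCUMULATED SYMMETRIC FRAMES AT A PLAQUETTE-SMALL SU(2) BACKGROUND, k-UNIFORMLY** ([Balaban1985Averaging] (161)–(163) for the centred symmetric frames):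
# the generic SU(2) theorem behind the (WIN-twˢ) window of part 2 (`Prop7DbarTwSymWindow`) — ★w4 g2's CLUSTER AXIAL GAUGE ∘ W0 ✓p616032 (the two distances are gauge invariant) ∘ W2 ✓p616274
# (the two-field tower on the cluster) ∘ ✓`Prop8Chart.norm_emlIterU_sub_one_le_of_reads`, with the covariant one-step rows displayed (`hstep`∕`hframe`, constant `C₁`)
# (route `UnitScaleTilt`, crux K1 «MinimiserStabilityRegPr» stmt-QuantumFields-19200, stub `stub_existenceMinimalOrbit` (EX), route (α), node (AVG-SYM); def-free, count-neutral)

Cell `ym3-torus` (HUMAN RULING D-0037, YM ladder rung R3 — YM₃ on T³ is a rung, not d = 4, not a mass gap, not Clay), width seat `ym-ust-20520-w4` (gen 3).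

THE PRINT.  [Balaban1985Averaging] (89)–(92) p. 31, (97) p. 32, (161)–(163) p. 42 («|U̿₁ʲ − 1| ≤ 2α₂ … |v_j − 1|, |v_j⁻¹ − 1| ≤ O(1)dLʲ|A|»), p. 44 («all operations … are done always in a
case where proper expressions are small» — in a convenient gauge), (11)–(12) p. 19 (covariance).

WHAT IS PROVED (sorry-free, no definition; generic `P : Params`, `k + 1 ≤ m + K`, `M₂ = Matrix (Fin 2) (Fin 2) ℂ` with the `L²`-operator norm; `ℓ = (d+2)L`, `s_B = 2d(3Lᵏ − 1)a₀`,
`x = Lᵏ(2t + 30ℓs_B)`, `D = 16C₁ + 2`):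
* ★★`norm_dbarCovIterU_rel_frameAccU_le_of_plaqSmall` — `PlaqSmall a₀ U₀`, complex `A` with `‖ηA(b)‖ ≤ t ≤ 1`, budgets `6400ℓ²Lᵏs_B ≤ 1`, `8Dℓ²x ≤ 1` ⟹ for every `k`-bond `e`:
  `‖U̿^{(k)}[e^{iηA}U₀♭](e)·Ū^{(k)}[U₀♭](e)⁻¹ − 1‖ ≤ 3x`, `‖w^{(k)}(e₋) − 1‖ ≤ 6ℓx`, `‖w^{(k)}(e₊) − 1‖ ≤ 6ℓx`.
HONEST FRAMING.  Bookkeeping; the one-step estimates are W1's (displayed); constants crude; nothing of print is asserted.  `--supports stmt-QuantumFields-19200 --as helper`.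

References: T. Bałaban, CMP 98 (1985) 17–51 [Balaban1985Averaging] ((11)–(12) p.19, (82) p.30, (89)–(92) p.31, (97) p.32, (161)–(163) p.42, p.44).
-/

set_option autoImplicit false

noncomputable section

open scoped BigOperators

namespace Summit.QuantumFields.YangMills.Theorems.Prop7SymFrameRelCluster

open Literature.MathematicalPhysics.QuantumFieldTheory.Balaban1983to89
open T4Continuum BlockAveraging
open B5Eq118OneStroke (iterBlockOf)
open B15DeterminingSets (embIter)
open B7Prop1Explicit (U1)
open B7Prop2SpecialUnitary (specialUnitaryUnits mem_specialUnitaryUnits specialUnitaryUnits_le_U1)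
open B10Eq27TorusAxialLog (axialT gaugeActT gaugeActT_apply unitsField toUField suIncl)
open Summit.QuantumFields.YangMills.Theorems.Prop8Chart (expCfg coe_expCfg emlAvgU emlIterU norm_emlIterU_sub_one_le_of_reads coe_unitsField_toUField norm_inv_sub_one_le_two_mul)
open B7TransferAnalyticMean (norm_exp_sub_one_le_two_mul)
open Summit.QuantumFields.YangMills.Theorems.IterPlaqSmallAllL (dist1_axial_cluster_le)
open Summit.QuantumFields.YangMills.Theorems.Prop7SymAvgRelativeBound (gaugeActT_mul_bg unitsField_toUField_gaugeActT norm_coe_toUnits_suIncl coe_toUnits_suIncl)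
open Summit.QuantumFields.YangMills.Theorems.Prop7SymAvgTwSym (vframeCovU dbarCovU dbarCovIterU frameAccU)
open Summit.QuantumFields.YangMills.Theorems.Prop7SymFrameCovariance (norm_frameAccU_gaugeActT_sub_one norm_dbarCovIterU_mul_inv_gaugeActT_sub_one)
open Summit.QuantumFields.YangMills.Theorems.Prop7SymFrameIterSmall (diff_frameAccU_le_of_reads budget_consequences)

variable {P : Params}

/-! ## §1 Generic SU(2): the covariant double-bar tower relative to the background tower, and the accumulated symmetric frames, at a plaquette-small background -/

section SU2

open scoped Matrix.Norms.L2Operator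

set_option maxHeartbeats 400000 in
/-- ★★ **THE RELATIVE TOP-LEVEL COVARIANT DOUBLE BAR `U̿^{(k)}(e)·Ū₀^{(k)}(e)⁻¹` AND THE ACCUMULATED SYMMETRIC FRAMES AT A PLAQUETTE-SMALL SU(2) BACKGROUND, k-UNIFORMLY**
([Balaban1985Averaging] (161)–(163) for the centred symmetric frames of OWNER RULING g26-№12).  Let `U₀` have every plaquette within `a₀` of `1`, `k + 1 ≤ m + K`, let the complex perturbation
satisfy `‖ηA(b)‖ ≤ t ≤ 1` bondwise, and put `s_B := 2d(3Lᵏ − 1)a₀`, `x := Lᵏ(2t + 30ℓs_B)` (`ℓ = (d+2)L`, `D = 16C₁ + 2`); under the budgets `6400ℓ²Lᵏs_B ≤ 1`, `8Dℓ²x ≤ 1`, and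
with the covariant one-step rows displayed (`hstep`∕`hframe`, constant `C₁`, smallness `120ℓ(s₀+s₁) ≤ 1` — ★w4-19200 g3's W1): for EVERY `k`-bond `e`,
`‖U̿^{(k)}[e^{iηA}U₀♭](e)·Ū^{(k)}[U₀♭](e)⁻¹ − 1‖ ≤ 3x` and `‖w^{(k)}(e₋) − 1‖, ‖w^{(k)}(e₊) − 1‖ ≤ 6ℓx`.  Proof: the cluster axial gauge `u = axialT U₀ (embIter k e₋)` (background
bonds under the four blocks of the cluster within `s_B` of `1`, ✓`IterPlaqSmallAllL.dist1_axial_cluster_le`), the gauged perturbed field differs from the gauged background by `2t` (unitary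
conjugation is an isometry), W2 ✓`diff_frameAccU_le_of_reads` on the cluster, the background tower's `30ℓLᵏs_B` (✓`norm_emlIterU_sub_one_le_of_reads`), and W0's gauge invariance of the two
distances (`norm_dbarCovIterU_mul_inv_gaugeActT_sub_one`, `norm_frameAccU_gaugeActT_sub_one`).
[cite: Balaban1985Averaging, (89)–(92) p.31, (97) p.32, (161)–(163) p.42, p.44, (11)–(12) p.19] -/
theorem norm_dbarCovIterU_rel_frameAccU_le_of_plaqSmall {C₁ : ℝ} (hC₁ : 2 ≤ C₁)
    (hstep : ∀ (j : ℕ), j + 1 ≤ P.m + P.K → ∀ (U₀ W : GaugeField P j (Matrix (Fin 2) (Fin 2) ℂ)ˣ) (c : PBond P (j + 1)) (s₀ s₁ δ : ℝ), 0 ≤ s₀ → 0 ≤ s₁ → 0 ≤ δ →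
      120 * (((P.d + 2) * P.L : ℕ) : ℝ) * (s₀ + s₁) ≤ 1 →
      (∀ b : PBond P j, (blockOf b.src = c.src ∨ blockOf b.src = c.tgt) → (blockOf b.tgt = c.src ∨ blockOf b.tgt = c.tgt) →
        ‖((U₀ b : (Matrix (Fin 2) (Fin 2) ℂ)ˣ) : Matrix (Fin 2) (Fin 2) ℂ) - 1‖ ≤ s₀ ∧ ‖((W b : (Matrix (Fin 2) (Fin 2) ℂ)ˣ) : Matrix (Fin 2) (Fin 2) ℂ) - 1‖ ≤ s₁ ∧
          ‖((W b : (Matrix (Fin 2) (Fin 2) ℂ)ˣ) : Matrix (Fin 2) (Fin 2) ℂ) - ((U₀ b : (Matrix (Fin 2) (Fin 2) ℂ)ˣ) : Matrix (Fin 2) (Fin 2) ℂ)‖ ≤ δ) →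
      ‖((dbarCovU U₀ W c : (Matrix (Fin 2) (Fin 2) ℂ)ˣ) : Matrix (Fin 2) (Fin 2) ℂ) * (((emlAvgU U₀ c)⁻¹ : (Matrix (Fin 2) (Fin 2) ℂ)ˣ) : Matrix (Fin 2) (Fin 2) ℂ) - 1‖ ≤
        (P.L : ℝ) * δ + C₁ * (((P.d + 2) * P.L : ℕ) : ℝ) ^ 2 * (s₀ + s₁) ^ 2)
    (hframe : ∀ (j : ℕ), j + 1 ≤ P.m + P.K → ∀ (U₀ W : GaugeField P j (Matrix (Fin 2) (Fin 2) ℂ)ˣ) (y : Site P (j + 1)) (s₀ s₁ δ : ℝ), 0 ≤ s₀ → 0 ≤ s₁ → 0 ≤ δ →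
      120 * (((P.d + 2) * P.L : ℕ) : ℝ) * (s₀ + s₁) ≤ 1 →
      (∀ b : PBond P j, blockOf b.src = y → blockOf b.tgt = y →
        ‖((U₀ b : (Matrix (Fin 2) (Fin 2) ℂ)ˣ) : Matrix (Fin 2) (Fin 2) ℂ) - 1‖ ≤ s₀ ∧ ‖((W b : (Matrix (Fin 2) (Fin 2) ℂ)ˣ) : Matrix (Fin 2) (Fin 2) ℂ) - 1‖ ≤ s₁ ∧
          ‖((W b : (Matrix (Fin 2) (Fin 2) ℂ)ˣ) : Matrix (Fin 2) (Fin 2) ℂ) - ((U₀ b : (Matrix (Fin 2) (Fin 2) ℂ)ˣ) : Matrix (Fin 2) (Fin 2) ℂ)‖ ≤ δ) →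
      ‖((vframeCovU U₀ W y : (Matrix (Fin 2) (Fin 2) ℂ)ˣ) : Matrix (Fin 2) (Fin 2) ℂ) - 1‖ ≤ (((P.d + 2) * P.L : ℕ) : ℝ) * δ + C₁ * (((P.d + 2) * P.L : ℕ) : ℝ) ^ 2 * (s₀ + s₁) ^ 2)
    {k : ℕ} (hk : k + 1 ≤ P.m + P.K) (U₀ : GaugeField P 0 (Matrix.specialUnitaryGroup (Fin 2) ℂ))
    {a₀ : ℝ} (ha₀ : 0 < a₀) (hU : PlaqSmall a₀ U₀) (η : ℝ) (A : PBond P 0 → Matrix (Fin 2) (Fin 2) ℂ) {t : ℝ} (ht1 : t ≤ 1)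
    (hA : ∀ b, ‖(η : ℂ) • A b‖ ≤ t)
    (hbud₀ : 6400 * (((P.d + 2) * P.L : ℕ) : ℝ) ^ 2 * (P.L : ℝ) ^ k * (2 * ((P.d : ℝ) * (3 * (P.L : ℝ) ^ k - 1)) * a₀) ≤ 1)
    (hbud : 8 * (16 * C₁ + 2) * (((P.d + 2) * P.L : ℕ) : ℝ) ^ 2 *
      ((P.L : ℝ) ^ k * (2 * t + 30 * (((P.d + 2) * P.L : ℕ) : ℝ) * (2 * ((P.d : ℝ) * (3 * (P.L : ℝ) ^ k - 1)) * a₀))) ≤ 1)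
    (e : PBond P k) :
    ‖((dbarCovIterU k (unitsField (toUField U₀)) (fun b => expCfg η A b * unitsField (toUField U₀) b) e : (Matrix (Fin 2) (Fin 2) ℂ)ˣ) : Matrix (Fin 2) (Fin 2) ℂ) *
          (((emlIterU k (unitsField (toUField U₀)) e)⁻¹ : (Matrix (Fin 2) (Fin 2) ℂ)ˣ) : Matrix (Fin 2) (Fin 2) ℂ) - 1‖ ≤
        3 * ((P.L : ℝ) ^ k * (2 * t + 30 * (((P.d + 2) * P.L : ℕ) : ℝ) * (2 * ((P.d : ℝ) * (3 * (P.L : ℝ) ^ k - 1)) * a₀))) ∧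
      ‖((frameAccU k (unitsField (toUField U₀)) (fun b => expCfg η A b * unitsField (toUField U₀) b) e.src : (Matrix (Fin 2) (Fin 2) ℂ)ˣ) : Matrix (Fin 2) (Fin 2) ℂ) - 1‖ ≤
        6 * (((P.d + 2) * P.L : ℕ) : ℝ) * ((P.L : ℝ) ^ k * (2 * t + 30 * (((P.d + 2) * P.L : ℕ) : ℝ) * (2 * ((P.d : ℝ) * (3 * (P.L : ℝ) ^ k - 1)) * a₀))) ∧
      ‖((frameAccU k (unitsField (toUField U₀)) (fun b => expCfg η A b * unitsField (toUField U₀) b) e.tgt : (Matrix (Fin 2) (Fin 2) ℂ)ˣ) : Matrix (Fin 2) (Fin 2) ℂ) - 1‖ ≤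
        6 * (((P.d + 2) * P.L : ℕ) : ℝ) * ((P.L : ℝ) ^ k * (2 * t + 30 * (((P.d + 2) * P.L : ℕ) : ℝ) * (2 * ((P.d : ℝ) * (3 * (P.L : ℝ) ^ k - 1)) * a₀))) := by
  set ℓ : ℝ := (((P.d + 2) * P.L : ℕ) : ℝ) with hℓ
  set sB : ℝ := 2 * ((P.d : ℝ) * (3 * (P.L : ℝ) ^ k - 1)) * a₀ with hsB
  set g : ℝ := 2 * t + 30 * ℓ * sB with hg
  set x : ℝ := (P.L : ℝ) ^ k * g with hx
  set D : ℝ := 16 * C₁ + 2 with hD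
  set z := e.src with hz
  set u : GaugeTransf P 0 (Matrix.specialUnitaryGroup (Fin 2) ℂ) := axialT U₀ (embIter k z) with hu
  set û : GaugeTransf P 0 (Matrix (Fin 2) (Fin 2) ℂ)ˣ := fun y => Unitary.toUnits (suIncl (u y)) with hû
  set V₂ : GaugeField P 0 (Matrix (Fin 2) (Fin 2) ℂ)ˣ := unitsField (toUField U₀) with hV₂
  set V₁ : GaugeField P 0 (Matrix (Fin 2) (Fin 2) ℂ)ˣ := fun b => expCfg η A b * V₂ b with hV₁
  have ht0 : 0 ≤ t := (norm_nonneg _).trans (hA ⟨embIter k e.src, e.dir⟩)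
  have hL2 : (2 : ℝ) ≤ P.L := by exact_mod_cast P.hL.2
  have hL1 : (1 : ℝ) ≤ P.L := by linarith
  have hL0 : (0 : ℝ) ≤ P.L := by linarith
  have hLℓ : (P.L : ℝ) ≤ ℓ := by
    rw [hℓ]; push_cast; nlinarith [show (0 : ℝ) ≤ (P.d : ℝ) from Nat.cast_nonneg _]
  have hℓ0 : 0 ≤ ℓ := by linarith
  have hsB0 : 0 ≤ sB := by
    rw [hsB]
    have h3 : (0 : ℝ) ≤ 3 * (P.L : ℝ) ^ k - 1 := by linarith [one_le_pow₀ (n := k) hL1]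
    positivity
  have hg0 : 0 ≤ g := by positivity
  have hx0 : 0 ≤ x := by positivity
  have hD34 : 34 ≤ D := by rw [hD]; linarith
  have hbud' : 8 * D * ℓ ^ 2 * x ≤ 1 := hbud
  -- the coherent family of gauge maps above `û`, all `SU(2)`-valued
  have hus : ∀ (i : ℕ) (y : Site P (i + 1)), transfUp û (i + 1) y = transfUp û i (emb y) := fun _ _ => rfl
  have htr : ∀ (j : ℕ) (y : Site P j), transfUp û j y = Unitary.toUnits (suIncl (transfUp u j y)) := by
    intro j
    induction j with
    | zero => intro y; rfl
    | succ j ih => intro y; exact ih (emb y)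
  have hU1 : ∀ (i : ℕ) (y : Site P i), transfUp û i y ∈ U1 (Matrix (Fin 2) (Fin 2) ℂ) := fun i y =>
    specialUnitaryUnits_le_U1 (by rw [htr, mem_specialUnitaryUnits]; exact (transfUp u i y).2)
  -- the cluster: both ends of `e`
  set S : Set (Site P k) := {w | w = z ∨ w = z.shift e.dir ∨ w = z.shift e.dir ∨ w = (z.shift e.dir).shift e.dir} with hS
  have hsrc : e.src ∈ S := Or.inl hz.symm
  have htgt : e.tgt ∈ S := Or.inr (Or.inl rfl)
  -- reads of the gauged background under the cluster (the cluster axial gauge)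
  have hreads₂ : ∀ b : PBond P 0, iterBlockOf k b.src ∈ S → iterBlockOf k b.tgt ∈ S →
      ‖((gaugeActT û V₂ b : (Matrix (Fin 2) (Fin 2) ℂ)ˣ) : Matrix (Fin 2) (Fin 2) ℂ) - 1‖ ≤ sB := by
    intro b hbs hbt
    rw [hû, hV₂, ← unitsField_toUField_gaugeActT, coe_unitsField_toUField, ← SU2Mean.dist1_eq_norm, hu]
    exact dist1_axial_cluster_le hk U₀ ha₀ hU z e.dir e.dir b hbs hbt
  -- the gauged perturbed field differs from the gauged background by `2t` (unitary conjugation is an isometry, the background bond has norm one)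
  have hE : ∀ b : PBond P 0, ‖((expCfg η A b : (Matrix (Fin 2) (Fin 2) ℂ)ˣ) : Matrix (Fin 2) (Fin 2) ℂ) - 1‖ ≤ 2 * t := by
    intro b
    have hI : ‖(Complex.I * (η : ℂ)) • A b‖ = ‖(η : ℂ) • A b‖ := by rw [mul_smul, norm_smul, Complex.norm_I, one_mul]
    rw [coe_expCfg]
    calc _ ≤ 2 * ‖(Complex.I * (η : ℂ)) • A b‖ := norm_exp_sub_one_le_two_mul (by rw [hI]; exact (hA b).trans ht1)
      _ ≤ 2 * t := by rw [hI]; linarith [hA b]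
  have hdiff : ∀ b : PBond P 0, iterBlockOf k b.src ∈ S → iterBlockOf k b.tgt ∈ S →
      ‖((gaugeActT û V₂ b : (Matrix (Fin 2) (Fin 2) ℂ)ˣ) : Matrix (Fin 2) (Fin 2) ℂ) - 1‖ ≤ sB ∧
        ‖((gaugeActT û V₁ b : (Matrix (Fin 2) (Fin 2) ℂ)ˣ) : Matrix (Fin 2) (Fin 2) ℂ) - ((gaugeActT û V₂ b : (Matrix (Fin 2) (Fin 2) ℂ)ˣ) : Matrix (Fin 2) (Fin 2) ℂ)‖ ≤ 2 * t := by
    intro b hbs hbt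
    refine ⟨hreads₂ b hbs hbt, ?_⟩
    have hval : ((gaugeActT û V₁ b : (Matrix (Fin 2) (Fin 2) ℂ)ˣ) : Matrix (Fin 2) (Fin 2) ℂ) =
        (((û b.src : (Matrix (Fin 2) (Fin 2) ℂ)ˣ) : Matrix (Fin 2) (Fin 2) ℂ) * ((expCfg η A b : (Matrix (Fin 2) (Fin 2) ℂ)ˣ) : Matrix (Fin 2) (Fin 2) ℂ) *
          (((û b.src)⁻¹ : (Matrix (Fin 2) (Fin 2) ℂ)ˣ) : Matrix (Fin 2) (Fin 2) ℂ)) * ((gaugeActT û V₂ b : (Matrix (Fin 2) (Fin 2) ℂ)ˣ) : Matrix (Fin 2) (Fin 2) ℂ) := by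
      rw [hV₁, gaugeActT_mul_bg]; simp only [Units.val_mul]
    have hn2 : ‖((gaugeActT û V₂ b : (Matrix (Fin 2) (Fin 2) ℂ)ˣ) : Matrix (Fin 2) (Fin 2) ℂ)‖ = 1 := by
      rw [hû, hV₂, ← unitsField_toUField_gaugeActT, coe_unitsField_toUField]
      exact Summit.QuantumFields.YangMills.Theorems.Prop8Criticality.norm_coe_su2 _
    have e1 : ((gaugeActT û V₁ b : (Matrix (Fin 2) (Fin 2) ℂ)ˣ) : Matrix (Fin 2) (Fin 2) ℂ) - ((gaugeActT û V₂ b : (Matrix (Fin 2) (Fin 2) ℂ)ˣ) : Matrix (Fin 2) (Fin 2) ℂ) =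
        (((û b.src : (Matrix (Fin 2) (Fin 2) ℂ)ˣ) : Matrix (Fin 2) (Fin 2) ℂ) * ((expCfg η A b : (Matrix (Fin 2) (Fin 2) ℂ)ˣ) : Matrix (Fin 2) (Fin 2) ℂ) *
          (((û b.src)⁻¹ : (Matrix (Fin 2) (Fin 2) ℂ)ˣ) : Matrix (Fin 2) (Fin 2) ℂ) - 1) * ((gaugeActT û V₂ b : (Matrix (Fin 2) (Fin 2) ℂ)ˣ) : Matrix (Fin 2) (Fin 2) ℂ) := by
      rw [hval, sub_mul, one_mul]
    rw [e1]
    calc _ ≤ ‖((û b.src : (Matrix (Fin 2) (Fin 2) ℂ)ˣ) : Matrix (Fin 2) (Fin 2) ℂ) * ((expCfg η A b : (Matrix (Fin 2) (Fin 2) ℂ)ˣ) : Matrix (Fin 2) (Fin 2) ℂ) *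
          (((û b.src)⁻¹ : (Matrix (Fin 2) (Fin 2) ℂ)ˣ) : Matrix (Fin 2) (Fin 2) ℂ) - 1‖ * ‖((gaugeActT û V₂ b : (Matrix (Fin 2) (Fin 2) ℂ)ˣ) : Matrix (Fin 2) (Fin 2) ℂ)‖ := norm_mul_le _ _
      _ ≤ 2 * t * 1 := by
          rw [hn2]
          refine mul_le_mul_of_nonneg_right ?_ zero_le_one
          exact (B12ContourAverage253.norm_units_conj_sub_one_eq (hU1 0 b.src) _).le.trans (hE b)
      _ = 2 * t := mul_one _
  -- W2 on the cluster for the gauged pair, with `(s₀, δ) := (s_B, 2t)`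
  have ht20 : 0 ≤ 2 * t := by positivity
  have hbud₀' : 6400 * ℓ ^ 2 * (P.L : ℝ) ^ k * sB ≤ 1 := hbud₀
  have hW2 := diff_frameAccU_le_of_reads (P := P) (𝔸 := Matrix (Fin 2) (Fin 2) ℂ) hC₁ hstep hframe k (Nat.le_of_succ_le hk) S (gaugeActT û V₂) (gaugeActT û V₁) sB (2 * t) hsB0 ht20
    hbud₀' hbud' hdiff
  obtain ⟨hΓ, hΦ⟩ := hW2
  rw [← hg, ← hx, ← hD] at hΓ
  rw [← hℓ, ← hg, ← hx] at hΦ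
  -- the background tower at the top on the cluster : `α ≤ 30ℓLᵏs_B ≤ x`
  have hα : ‖((emlIterU k (gaugeActT û V₂) e : (Matrix (Fin 2) (Fin 2) ℂ)ˣ) : Matrix (Fin 2) (Fin 2) ℂ) - 1‖ ≤ x := by
    have h := norm_emlIterU_sub_one_le_of_reads (Nat.le_of_succ_le hk) S (gaugeActT û V₂) hsB0 hbud₀' hreads₂ e hsrc htgt
    refine h.trans ?_
    have e1 : x = (P.L : ℝ) ^ k * (2 * t) + 30 * ℓ * (P.L : ℝ) ^ k * sB := by rw [hx, hg]; ring
    rw [← hℓ, e1]; nlinarith [pow_nonneg hL0 k, mul_nonneg (pow_nonneg hL0 k) ht20]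
  obtain ⟨hℓx, hDx, -⟩ := budget_consequences (L := (P.L : ℝ)) (x := x / P.L) hL2 hLℓ hD34 (by positivity)
    (by rw [mul_div_cancel₀ _ (by linarith : (P.L : ℝ) ≠ 0)]; exact hbud')
  have hxs : x ≤ 1 / 16 := by
    -- `x = L·(x/L) ≤ ℓ·(x/L) ≤ 1/544`
    have h1 : x = P.L * (x / P.L) := by rw [mul_div_cancel₀ _ (by linarith : (P.L : ℝ) ≠ 0)]
    have h2 : P.L * (x / P.L) ≤ ℓ * (x / P.L) := mul_le_mul_of_nonneg_right hLℓ (by positivity)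
    linarith
  have hσ2 : x * (1 + D * ℓ ^ 2 * x) ≤ 2 * x := by
    have : D * ℓ ^ 2 * x ≤ 1 := by nlinarith [hbud', mul_nonneg (by linarith : (0:ℝ) ≤ D) (mul_nonneg (sq_nonneg ℓ) hx0)]
    nlinarith
  -- the relative double bar in the gauged picture: `‖X·Y⁻¹ − 1‖ ≤ ‖X − Y‖·‖Y⁻¹‖ ≤ σ·(1 + 2α)`
  have hrel : ‖((dbarCovIterU k (gaugeActT û V₂) (gaugeActT û V₁) e : (Matrix (Fin 2) (Fin 2) ℂ)ˣ) : Matrix (Fin 2) (Fin 2) ℂ) *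
        (((emlIterU k (gaugeActT û V₂) e)⁻¹ : (Matrix (Fin 2) (Fin 2) ℂ)ˣ) : Matrix (Fin 2) (Fin 2) ℂ) - 1‖ ≤ 3 * x := by
    set X : Matrix (Fin 2) (Fin 2) ℂ := ((dbarCovIterU k (gaugeActT û V₂) (gaugeActT û V₁) e : (Matrix (Fin 2) (Fin 2) ℂ)ˣ) : Matrix (Fin 2) (Fin 2) ℂ) with hX
    set Y : (Matrix (Fin 2) (Fin 2) ℂ)ˣ := emlIterU k (gaugeActT û V₂) e with hY
    have hd := hΓ e hsrc htgt
    have hinv : ‖((Y⁻¹ : (Matrix (Fin 2) (Fin 2) ℂ)ˣ) : Matrix (Fin 2) (Fin 2) ℂ) - 1‖ ≤ 2 * x := norm_inv_sub_one_le_two_mul hα (by linarith)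
    have hinv' : ‖((Y⁻¹ : (Matrix (Fin 2) (Fin 2) ℂ)ˣ) : Matrix (Fin 2) (Fin 2) ℂ)‖ ≤ 1 + 2 * x := by
      calc ‖((Y⁻¹ : (Matrix (Fin 2) (Fin 2) ℂ)ˣ) : Matrix (Fin 2) (Fin 2) ℂ)‖
          = ‖(((Y⁻¹ : (Matrix (Fin 2) (Fin 2) ℂ)ˣ) : Matrix (Fin 2) (Fin 2) ℂ) - 1) + 1‖ := by rw [sub_add_cancel]
        _ ≤ ‖((Y⁻¹ : (Matrix (Fin 2) (Fin 2) ℂ)ˣ) : Matrix (Fin 2) (Fin 2) ℂ) - 1‖ + ‖(1 : Matrix (Fin 2) (Fin 2) ℂ)‖ := norm_add_le _ _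
        _ ≤ 2 * x + 1 := add_le_add hinv (by rw [norm_one])
        _ = 1 + 2 * x := add_comm _ _
    have e1 : X * ((Y⁻¹ : (Matrix (Fin 2) (Fin 2) ℂ)ˣ) : Matrix (Fin 2) (Fin 2) ℂ) - 1 = (X - (Y : Matrix (Fin 2) (Fin 2) ℂ)) * ((Y⁻¹ : (Matrix (Fin 2) (Fin 2) ℂ)ˣ) : Matrix (Fin 2) (Fin 2) ℂ) := by
      rw [sub_mul, Units.mul_inv]
    rw [e1]
    calc _ ≤ ‖X - (Y : Matrix (Fin 2) (Fin 2) ℂ)‖ * ‖((Y⁻¹ : (Matrix (Fin 2) (Fin 2) ℂ)ˣ) : Matrix (Fin 2) (Fin 2) ℂ)‖ := norm_mul_le _ _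
      _ ≤ (x * (1 + D * ℓ ^ 2 * x)) * (1 + 2 * x) := mul_le_mul hd hinv' (norm_nonneg _) (by positivity)
      _ ≤ 3 * x := by nlinarith [mul_nonneg hx0 hx0]
  -- back to the ungauged objects by W0's invariance
  have hV₁u : gaugeActT (transfUp û 0) V₁ = gaugeActT û V₁ := rfl
  have hV₂u : gaugeActT (transfUp û 0) V₂ = gaugeActT û V₂ := rfl
  refine ⟨?_, ?_, ?_⟩
  · rw [norm_dbarCovIterU_mul_inv_gaugeActT_sub_one (transfUp û) hus hU1 V₂ V₁ k e, hV₁u, hV₂u]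
    exact hrel
  · rw [← norm_frameAccU_gaugeActT_sub_one (transfUp û) hus hU1 V₂ V₁ k e.src, hV₁u, hV₂u]
    exact hΦ e.src hsrc
  · rw [← norm_frameAccU_gaugeActT_sub_one (transfUp û) hus hU1 V₂ V₁ k e.tgt, hV₁u, hV₂u]
    exact hΦ e.tgt htgt

end SU2

end Summit.QuantumFields.YangMills.Theorems.Prop7SymFrameRelCluster

end
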